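import Literature.AlgebraicGeometry.HodgeTheory.ProjectiveSubquotientCastelnuovoMumfordRegularity
import Literature.AlgebraicGeometry.HodgeTheory.ProjectiveMumfordRegularityBound
import HarnessLib

/-!
# `h⁰(M~(n)) = P_M(n)` for `n ≫ 0`, and from `n ≥ reg - 1` on (Serre; Mumford Lecture 14)

Hartshorne, *Algebraic Geometry*, III Thm. 5.2 (b) (Serre): `H^i(X, 𝓕(n)) = 0` for `i > 0`, `n ≫ 0`;
with III Ex. 5.2 (`χ(𝓕(n)) = P_𝓕(n)` for all `n`) this gives **`h⁰(𝓕(n)) = P_𝓕(n)` for all `n ≫ 0`**,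
and Mumford's Castelnuovo lemma (b) (Lecture 14, p. 99) makes the threshold effective: **`n ≥ m - 1`
for an `m`-regular `𝓕`** (all `H^i(𝓕(n))`, `i ≥ 1`, vanish when `n + i ≥ m`).

In the tree's Čech language the quotient case `𝓕 = (F_e ⧸ K)~` of the effective statement is
`ProjectiveCastelnuovoMumfordRegularityComplements.finrank_homology_quot_zero_eq_eval_of_regular`; this
file adds the eventual statements (any field) and the subquotient case `𝓕 = (N' ⧸ N)~` (ideal sheaves
`𝓘_{Z ⊂ X}`):

* `LaurentCech.exists_forall_finrank_homology_quot_zero_eq_eval` — `∃ n₀, ∀ n ≥ n₀, h⁰(Č_n(F_e ⧸ K)) = Q(n)`;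
* `LaurentCech.exists_forall_finrank_homology_subquot_zero_eq_eval` — the same for `N' ⧸ N`;
* **`LaurentCech.finrank_homology_subquot_zero_eq_eval_of_regular`** — for an `m`-regular `(N' ⧸ N)~`
  (`k` infinite): `h⁰(Č_n(N' ⧸ N)) = Q(n)` for all `n ≥ m - 1`;
  `LaurentCech.isZero_homology_subquot_pos_of_regular` — and `H^i(Č_n(N' ⧸ N)) = 0`, `i ≥ 1`, there.

## References

* [Hartshorne1977] R. Hartshorne, *Algebraic Geometry*, III Thm. 5.2 (b) (p. 228), III Ex. 5.2 (p. 230).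
* [Mumford1966CurvesSurface] D. Mumford, *Lectures on Curves on an Algebraic Surface*, Lecture 14
  (pp. 99–101).
-/

noncomputable section

open CategoryTheory CategoryTheory.Limits Polynomial

universe u

namespace Literature.Algebra.Homology

namespace LaurentCech

open OrderedCech TopCohomology

section AnyField

variable {k : Type u} [Field k] {r : ℕ} {J : Type} [Fintype J] (e : J → ℤ)

/-- **`h⁰(Č_n(F_e ⧸ K)) = Q(n)` for all `n ≫ 0`** (`K` graded, any field): Serre's vanishing of the
`H^i`, `i ≥ 1`, for large twists, and `χ = Q`. [cite: Hartshorne1977, III Thm. 5.2 (b) (p. 228)]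
[cite: Hartshorne1977, III Ex. 5.2 (p. 230)] -/
theorem exists_forall_finrank_homology_quot_zero_eq_eval {K : Submodule (P k r) (J → P k r)}
    (hK : IsGraded e K) {Q : ℚ[X]}
    (hQ : ∀ n : ℤ, ((∑ q ∈ Finset.range (r + 1), (-1 : ℤ) ^ q *
      (Module.finrank k ((quot e K n).homology q) : ℤ) : ℤ) : ℚ) = Q.eval (n : ℚ)) :
    ∃ n₀ : ℤ, ∀ n : ℤ, n₀ ≤ n →
      (Module.finrank k ((quot e K n).homology 0) : ℚ) = Q.eval (n : ℚ) := by
  obtain ⟨d₀, hd₀⟩ := exists_forall_isZero_homology_quot e hK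
  refine ⟨d₀, fun n hn => ?_⟩
  rw [← hQ n, Finset.sum_eq_single_of_mem 0 (Finset.mem_range.2 (Nat.succ_pos r))]
  · simp
  · intro q _ hq
    haveI := ModuleCat.subsingleton_of_isZero (hd₀ n hn q (by omega))
    rw [Module.finrank_zero_of_subsingleton, Nat.cast_zero, mul_zero]

/-- **`h⁰(Č_n(N' ⧸ N)) = Q(n)` for all `n ≫ 0`** for a graded subquotient (any field).
[cite: Hartshorne1977, III Thm. 5.2 (b) (p. 228)] [cite: Hartshorne1977, III Ex. 5.2 (p. 230)] -/
theorem exists_forall_finrank_homology_subquot_zero_eq_eval {N N' : Submodule (P k r) (J → P k r)}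
    (hN : IsGraded e N) (hN' : IsGraded e N') (h : N ≤ N') {Q : ℚ[X]}
    (hQ : ∀ n : ℤ, ((∑ q ∈ Finset.range (r + 1), (-1 : ℤ) ^ q *
      (Module.finrank k ((subquot e N N' h n).homology q) : ℤ) : ℤ) : ℚ) = Q.eval (n : ℚ)) :
    ∃ n₀ : ℤ, ∀ n : ℤ, n₀ ≤ n →
      (Module.finrank k ((subquot e N N' h n).homology 0) : ℚ) = Q.eval (n : ℚ) := by
  obtain ⟨d₀, hd₀⟩ := exists_forall_isZero_homology_subquot e hN hN' h
  refine ⟨d₀, fun n hn => ?_⟩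
  rw [← hQ n, ← eulerCharSubquot_def, eulerCharSubquot_eq_finrank_zero_of_isZero e h n
    (fun q hq => hd₀ n hn q hq), Int.cast_natCast]

end AnyField

section Regular

variable {k : Type u} [Field k] [Infinite k] {r : ℕ} {J : Type} [Fintype J] (e : J → ℤ)

/-- For an `m`-regular `(N' ⧸ N)~` and `n ≥ m - 1`, all `H^i(Č_n(N' ⧸ N))`, `i ≥ 1`, vanish
(Castelnuovo (b) in Mumford's indexing `n + i ≥ m`). [cite: Mumford1966CurvesSurface, Lecture 14 (p. 99)] -/
theorem isZero_homology_subquot_pos_of_regular {N N' : Submodule (P k r) (J → P k r)}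
    (hN : IsGraded e N) (hN' : IsGraded e N') (h : N ≤ N') (m : ℤ)
    (hm : ∀ i : ℤ, 1 ≤ i → IsZero ((subquot e N N' h (m - i)).homology i)) {n : ℤ}
    (hn : m - 1 ≤ n) : ∀ i : ℤ, 1 ≤ i → IsZero ((subquot e N N' h n).homology i) :=
  fun i hi => isZero_homology_subquot_of_regular' e hN hN' h m hm hi (by omega)

/-- **For an `m`-regular `(N' ⧸ N)~` and `n ≥ m - 1`: `h⁰(Č_n(N' ⧸ N)) = Q(n)`**, the value of the
`χ`-polynomial (`k` infinite; the subquotient form of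
`finrank_homology_quot_zero_eq_eval_of_regular`). [cite: Mumford1966CurvesSurface, Lecture 14 (pp. 99–101)]
[cite: Hartshorne1977, III Ex. 5.2 (p. 230)] -/
theorem finrank_homology_subquot_zero_eq_eval_of_regular {N N' : Submodule (P k r) (J → P k r)}
    (hN : IsGraded e N) (hN' : IsGraded e N') (h : N ≤ N') (m : ℤ)
    (hm : ∀ i : ℤ, 1 ≤ i → IsZero ((subquot e N N' h (m - i)).homology i)) {Q : ℚ[X]}
    (hQ : ∀ n : ℤ, ((∑ q ∈ Finset.range (r + 1), (-1 : ℤ) ^ q *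
      (Module.finrank k ((subquot e N N' h n).homology q) : ℤ) : ℤ) : ℚ) = Q.eval (n : ℚ))
    {n : ℤ} (hn : m - 1 ≤ n) :
    (Module.finrank k ((subquot e N N' h n).homology 0) : ℚ) = Q.eval (n : ℚ) := by
  rw [← hQ n, ← eulerCharSubquot_def, eulerCharSubquot_eq_finrank_zero_of_isZero e h n
    (isZero_homology_subquot_pos_of_regular e hN hN' h m hm hn), Int.cast_natCast]

end Regular

end LaurentCech

end Literature.Algebra.Homology

end
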